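import Summits.NavierStokesRegularity.NavierStokesRegularity.Theorems.AxisTwistDoorAveragedConeLiouvilleNUEnergyClassTools
import Literature.Analysis.FluidPDE.BiotSavartCurlPair
import HarnessLib

/-!
# N4 piece P4a (N-W′, analytic half): a CLASSICAL supersolution of `∂ₜΦ − ΔΦ + U·∇Φ ≥ 0` with a
# `C¹` divergence-free drift on the frame `]-R², 0[ × B(0, R')`, `R' > 2R`, lies in the axis-free
# energy class `NUEnergyClass Φ U k R`

Route `AxisTwistDoor`, crux `AveragedConeLiouville` (stmt-NavierStokesRegularity-26889), INPUT N4
(Nazarov–Ural'tseva 2011 §3 = Lei–Ren–Tian 2025 Lemma 2.5), cut of record pub/ns-inputs STATUS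
2026-08-28T11:29:42Z, texts `kits/N4-skeleton.lean` (5372b51f971b2f9d). This file is the analytic
core of `Sig.nu_standing_of_classical`: the energy inequalities of N–U (3.2)/(3.9) for every
admissible `H`, cut-off `Θ ⊆ B(0,2R)` and time weight `η`, in the v3 split slab form of
`NUEnergyClass` (`…NUDefs`).

PROOF = NO NEW ANALYSIS: the landed across-the-axis energy inequality of the A1 programme
(`energyClass_ineq_acrossAxis_v3`, es-p1 g3, p618452/p620006 — any open set `O`, drift `C¹` and
divergence free OFF the axis, supersolution inequality WITH the axial drift `(2/ϱ)∂_ϱ` OFF the axis,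
hypothesis `Φ ≥ k` ON the axis) is applied to the TRANSLATED data `Ψ(t,y) = Φ(t, y − c)`,
`c = 2R' e₀`, on the ball `B(c, R')`, which does not meet the axis (`ϱ > R'` there): the on-axis
hypothesis is vacuous, and the axial drift is cancelled by the explicit divergence-free field
`−(2/ϱ)e_ϱ = −(2/ϱ²)x_h` (`…RadialDrift`, cas-k2, p622656: `C¹`, bounded by `2/R'`, divergence free
off the axis), i.e. the theorem is used with the drift `W = U(·, · − c) − (2/ϱ)e_ϱ`, for which
`DΨ[W] + (2/ϱ)∂_ϱΨ = DΦ[U]`. Its drift and axis integrals then add up to the `U`-drift integral, and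
every integral is translated back by `y ↦ y + c` (Lebesgue measure on `ℝ × ℝ³` is translation
invariant; the slab `[t₁,t₂] × ℝ³` is invariant).

WHAT THIS IS NOT: not a statement about Navier–Stokes; N4 is an INPUT; item 26889 and the summit
stay open. [cite: NazarovUraltseva2011HarnackDivFree, §3 (3.2), (3.9) (arXiv:1011.1888 pp. 8–9)]
-/

noncomputable section

-- the summit and its single sub-problem share the name (CONVENTIONS §1)
set_option linter.dupNamespace false

open MeasureTheory Set Function Filter Topology Metric
open scoped NNReal ENNReal InnerProductSpace RealInnerProductSpace Laplacian
open Literature.Analysis Literature.Analysis.FluidPDE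
open Summit.NavierStokesRegularity.NavierStokesRegularity.Theorems.AxisymmetricKatoGlobal.EulerScaling
open Summit.NavierStokesRegularity.NavierStokesRegularity.Theorems.AveragedConeLiouville.RadialDrift

namespace Summit.NavierStokesRegularity.NavierStokesRegularity.Theorems.AveragedConeLiouville.NUPositivity

/-! ### The energy class of a classical supersolution -/

/-- **N-W′, analytic half: a classical supersolution of `∂ₜΦ − ΔΦ + U·∇Φ ≥ 0` on the frame
`]-R², 0[ × B(0, R')` (`R' > 2R`; `Φ ∈ C²`, `U ∈ C¹` jointly, `U` bounded and divergence free)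
satisfies the axis-free energy class `NUEnergyClass Φ U k R` for every level cap `k`.**
Proof: the landed `energyClass_ineq_acrossAxis_v3` for the translate `Φ(·, · − c)` on the off-axis
ball `B(c, R')`, `c = 2R'e₀`, with the drift `U(·, · − c) − (2/ϱ)e_ϱ` (module docstring).
[cite: NazarovUraltseva2011HarnackDivFree, §3 (3.2), (3.9) (arXiv:1011.1888 pp. 8–9)] -/
theorem nuEnergyClass_of_supersolution
    {Φ : ℝ → EuclideanSpace ℝ (Fin 3) → ℝ}
    {U : ℝ → EuclideanSpace ℝ (Fin 3) → EuclideanSpace ℝ (Fin 3)} {R R' Λ : ℝ} (k : ℝ)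
    (hR : 0 < R) (hRR' : 2 * R < R')
    (hΦ2 : ContDiffOn ℝ 2 (uncurry Φ) (Ioo (-R ^ 2) 0 ×ˢ ball (0 : EuclideanSpace ℝ (Fin 3)) R'))
    (hU1 : ContDiffOn ℝ 1 (uncurry U) (Ioo (-R ^ 2) 0 ×ˢ ball (0 : EuclideanSpace ℝ (Fin 3)) R'))
    (hUΛ : ∀ z ∈ Ioo (-R ^ 2) 0 ×ˢ ball (0 : EuclideanSpace ℝ (Fin 3)) R', ‖U z.1 z.2‖ ≤ Λ)
    (hdiv : ∀ z ∈ Ioo (-R ^ 2) 0 ×ˢ ball (0 : EuclideanSpace ℝ (Fin 3)) R',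
      VectorCalculus.divergence (U z.1) z.2 = 0)
    (hsup : ∀ z ∈ Ioo (-R ^ 2) 0 ×ˢ ball (0 : EuclideanSpace ℝ (Fin 3)) R',
      0 ≤ deriv (fun r => Φ r z.2) z.1 + fderiv ℝ (Φ z.1) z.2 (U z.1 z.2) - (Δ (Φ z.1)) z.2) :
    NUEnergyClass Φ U k R := by
  intro H hH hH' hH0 hH2 hκ hHk Θ hΘ hΘc hΘR η hη hη0 t₁ t₂ h1 h12 h2
  ----------------------------------------------------------------
  -- geometry: the off-axis ball `O = B(c, R')`, `c = 2R' e₀`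
  ----------------------------------------------------------------
  have hR' : 0 < R' := by linarith
  set c : EuclideanSpace ℝ (Fin 3) := EuclideanSpace.single (0 : Fin 3) (2 * R') with hc
  set O : Set (EuclideanSpace ℝ (Fin 3)) := ball c R' with hO
  have hOopen : IsOpen O := isOpen_ball
  have hOρ : ∀ y ∈ O, R' < cylRadius y := fun y hy => lt_cylRadius_of_mem_ball hy
  have hOρ0 : ∀ y ∈ O, cylRadius y ≠ 0 := fun y hy => (hR'.trans (hOρ y hy)).ne'
  have hOshift : ∀ y ∈ O, y - c ∈ ball (0 : EuclideanSpace ℝ (Fin 3)) R' := by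
    intro y hy
    rw [mem_ball_zero_iff]
    rwa [hO, mem_ball, dist_eq_norm] at hy
  set S : Set (ℝ × EuclideanSpace ℝ (Fin 3)) := Ioo (-R ^ 2) 0 ×ˢ ball (0 : EuclideanSpace ℝ (Fin 3)) R'
    with hS
  set S' : Set (ℝ × EuclideanSpace ℝ (Fin 3)) := Ioo (-R ^ 2) 0 ×ˢ O with hS'
  have hS'open : IsOpen S' := isOpen_Ioo.prod hOopen
  have hshift : ∀ z ∈ S', (z.1, z.2 - c) ∈ S := fun z hz => ⟨hz.1, hOshift z.2 hz.2⟩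
  have hS'sub : Ioo (-R ^ 2) 0 ×ˢ (O ∩ {x : EuclideanSpace ℝ (Fin 3) | cylRadius x ≠ 0}) ⊆ S' :=
    Set.prod_mono Subset.rfl inter_subset_left
  ----------------------------------------------------------------
  -- translated data
  ----------------------------------------------------------------
  set Ψ : ℝ → EuclideanSpace ℝ (Fin 3) → ℝ := fun t y => Φ t (y - c) with hΨ
  set RD : EuclideanSpace ℝ (Fin 3) → EuclideanSpace ℝ (Fin 3) := fun y =>
    (2 / cylRadius y ^ 2) • (y 0 • EuclideanSpace.single (0 : Fin 3) (1 : ℝ) +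
      y 1 • EuclideanSpace.single (1 : Fin 3) (1 : ℝ)) with hRD
  set Us : ℝ → EuclideanSpace ℝ (Fin 3) → EuclideanSpace ℝ (Fin 3) := fun t y => U t (y - c) with hUs
  set W : ℝ → EuclideanSpace ℝ (Fin 3) → EuclideanSpace ℝ (Fin 3) := fun t y => Us t y - RD y with hW
  have hRDeq : ∀ y, RD y = (2 / cylRadius y) • eR y := fun y => (two_div_cylRadius_smul_eR y).symm
  have hτ2 : ContDiff ℝ 2 (fun z : ℝ × EuclideanSpace ℝ (Fin 3) => (z.1, z.2 - c)) :=
    contDiff_fst.prodMk (contDiff_snd.sub contDiff_const)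
  have hΨ2 : ContDiffOn ℝ 2 (uncurry Ψ) S' := by
    have e : uncurry Ψ = uncurry Φ ∘ fun z : ℝ × EuclideanSpace ℝ (Fin 3) => (z.1, z.2 - c) := by
      funext z; rfl
    rw [e]
    exact hΦ2.comp hτ2.contDiffOn fun z hz => hshift z hz
  have hUs1 : ContDiffOn ℝ 1 (uncurry Us) S' := by
    have e : uncurry Us = uncurry U ∘ fun z : ℝ × EuclideanSpace ℝ (Fin 3) => (z.1, z.2 - c) := by
      funext z; rfl
    rw [e]
    exact hU1.comp (hτ2.of_le (by norm_num)).contDiffOn fun z hz => hshift z hz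
  have hRD1 : ContDiffOn ℝ 1 RD O := (contDiffOn_radialDrift 2 hR').mono fun y hy => hOρ y hy
  have hRDbd : ∀ y ∈ O, ‖RD y‖ ≤ 2 / R' := fun y hy => by
    have h := norm_radialDrift_le 2 hR' (hOρ y hy)
    rw [abs_of_pos (two_pos : (0:ℝ) < 2)] at h
    exact h
  ----------------------------------------------------------------
  -- the hypotheses of the across-the-axis energy inequality for `(Ψ, W)` on `O`
  ----------------------------------------------------------------
  have hΨc : ContinuousOn (uncurry Ψ) S' := hΨ2.continuousOn
  have hΨg : ContinuousOn (fun z : ℝ × EuclideanSpace ℝ (Fin 3) => fderiv ℝ (Ψ z.1) z.2) S' :=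
    continuousOn_fderiv_slice_of_contDiffOn hS'open hΨ2 (by norm_num)
  have hΨs : ∀ z ∈ Ioo (-R ^ 2) 0 ×ˢ (O ∩ {x : EuclideanSpace ℝ (Fin 3) | cylRadius x ≠ 0}),
      ContDiffAt ℝ 2 (Ψ z.1) z.2 := fun z hz =>
    contDiffAt_slice_of_contDiffOn hS'open hΨ2 (hS'sub hz)
  have hΨt : ∀ z ∈ Ioo (-R ^ 2) 0 ×ˢ (O ∩ {x : EuclideanSpace ℝ (Fin 3) | cylRadius x ≠ 0}),
      DifferentiableAt ℝ (fun r => Ψ r z.2) z.1 := fun z hz =>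
    (hasDerivAt_timeLine_of_contDiffOn hS'open hΨ2 (by norm_num) (hS'sub hz)).differentiableAt
  have hΨt' : ContinuousOn (fun z : ℝ × EuclideanSpace ℝ (Fin 3) => deriv (fun r => Ψ r z.2) z.1)
      (Ioo (-R ^ 2) 0 ×ˢ (O ∩ {x : EuclideanSpace ℝ (Fin 3) | cylRadius x ≠ 0})) :=
    (continuousOn_deriv_timeLine_of_contDiffOn hS'open hΨ2 (by norm_num)).mono hS'sub
  have hWc' : ContinuousOn (uncurry W) S' := by
    have h1 : ContinuousOn (uncurry Us) S' := hUs1.continuousOn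
    have h2 : ContinuousOn (fun z : ℝ × EuclideanSpace ℝ (Fin 3) => RD z.2) S' :=
      hRD1.continuousOn.comp continuousOn_snd fun z hz => hz.2
    exact h1.sub h2
  have hWc : ContinuousOn (uncurry W)
      (Ioo (-R ^ 2) 0 ×ˢ (O ∩ {x : EuclideanSpace ℝ (Fin 3) | cylRadius x ≠ 0})) := hWc'.mono hS'sub
  have hWs : ∀ z ∈ Ioo (-R ^ 2) 0 ×ˢ (O ∩ {x : EuclideanSpace ℝ (Fin 3) | cylRadius x ≠ 0}),
      ContDiffAt ℝ 1 (W z.1) z.2 := fun z hz =>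
    (contDiffAt_slice_of_contDiffOn hS'open hUs1 (hS'sub hz)).sub
      (hRD1.contDiffAt (hOopen.mem_nhds hz.2.1))
  have hdivW : ∀ z ∈ Ioo (-R ^ 2) 0 ×ˢ (O ∩ {x : EuclideanSpace ℝ (Fin 3) | cylRadius x ≠ 0}),
      VectorCalculus.divergence (W z.1) z.2 = 0 := by
    intro z hz
    have hA : DifferentiableAt ℝ (Us z.1) z.2 :=
      (contDiffAt_slice_of_contDiffOn hS'open hUs1 (hS'sub hz)).differentiableAt one_ne_zero
    have hB : DifferentiableAt ℝ RD z.2 :=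
      (hRD1.contDiffAt (hOopen.mem_nhds hz.2.1)).differentiableAt one_ne_zero
    have e1 : W z.1 = Us z.1 - RD := rfl
    have e2 : fderiv ℝ (Us z.1) z.2 = fderiv ℝ (U z.1) (z.2 - c) := fderiv_comp_sub_const' (U z.1) c z.2
    unfold VectorCalculus.divergence
    rw [e1, fderiv_sub hA hB, ContinuousLinearMap.toLinearMap_sub, map_sub, e2]
    have h3 := hdiv (z.1, z.2 - c) (hshift z (hS'sub hz))
    have h4 := divergence_radialDrift 2 hz.2.2
    unfold VectorCalculus.divergence at h3 h4
    simp only at h3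
    rw [h3, h4, sub_zero]
  have hW3 : (∫⁻ z in Ioo (-R ^ 2) 0 ×ˢ O, ‖W z.1 z.2‖ₑ ^ (3 : ℕ)) < ⊤ := by
    have hbd : ∀ z ∈ S', ‖W z.1 z.2‖ₑ ^ (3 : ℕ) ≤ ENNReal.ofReal (Λ + 2 / R') ^ (3 : ℕ) := by
      intro z hz
      have h1 : ‖W z.1 z.2‖ ≤ Λ + 2 / R' := by
        calc ‖W z.1 z.2‖ = ‖U z.1 (z.2 - c) - RD z.2‖ := rfl
          _ ≤ ‖U z.1 (z.2 - c)‖ + ‖RD z.2‖ := norm_sub_le _ _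
          _ ≤ Λ + 2 / R' := add_le_add (hUΛ (z.1, z.2 - c) (hshift z hz)) (hRDbd z.2 hz.2)
      have h2 : ‖W z.1 z.2‖ₑ ≤ ENNReal.ofReal (Λ + 2 / R') := by
        rw [← ofReal_norm]; exact ENNReal.ofReal_le_ofReal h1
      exact pow_le_pow_left' h2 3
    refine lt_of_le_of_lt (setLIntegral_mono measurable_const hbd) ?_
    rw [setLIntegral_const]
    refine ENNReal.mul_lt_top (ENNReal.pow_lt_top ENNReal.ofReal_lt_top) ?_
    exact (measure_mono (Set.prod_mono Ioo_subset_Icc_self ball_subset_closedBall)).trans_lt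
      ((isCompact_Icc.prod (isCompact_closedBall _ _)).measure_lt_top)
  have hsup' : ∀ z ∈ Ioo (-R ^ 2) 0 ×ˢ (O ∩ {x : EuclideanSpace ℝ (Fin 3) | cylRadius x ≠ 0}),
      0 ≤ deriv (fun r => Ψ r z.2) z.1 + fderiv ℝ (Ψ z.1) z.2 (W z.1 z.2) +
        2 / cylRadius z.2 * partialDeriv (eR z.2) (Ψ z.1) z.2 - (Laplacian.laplacian (Ψ z.1)) z.2 := by
    intro z hz
    have h0 := hsup (z.1, z.2 - c) (hshift z (hS'sub hz))
    simp only at h0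
    have e1 : (fun r => Ψ r z.2) = fun r => Φ r (z.2 - c) := rfl
    have e2 : fderiv ℝ (Ψ z.1) z.2 = fderiv ℝ (Φ z.1) (z.2 - c) := fderiv_comp_sub_const' (Φ z.1) c z.2
    have e3 : (Laplacian.laplacian (Ψ z.1)) z.2 = (Laplacian.laplacian (Φ z.1)) (z.2 - c) :=
      laplacian_comp_sub_const (Φ z.1) c z.2
    have e4 : W z.1 z.2 = U z.1 (z.2 - c) - (2 / cylRadius z.2) • eR z.2 := by
      show Us z.1 z.2 - RD z.2 = _; rw [hRDeq]
    rw [e1, e2, e3, e4, partialDeriv_apply, e2, map_sub, map_smul, smul_eq_mul]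
    linarith
  have hk' : ∀ z ∈ Ioo (-R ^ 2) 0 ×ˢ O, cylRadius z.2 = 0 → k ≤ Ψ z.1 z.2 :=
    fun z hz h0 => absurd h0 (hOρ0 z.2 hz.2)
  -- the translated cut-off
  set Θ' : EuclideanSpace ℝ (Fin 3) → ℝ := fun y => Θ (y - c) with hΘ'
  have hΘ'1 : ContDiff ℝ 1 Θ' := hΘ.comp (contDiff_id.sub contDiff_const)
  have hΘ'c : HasCompactSupport Θ' := hΘc.comp_homeomorph (Homeomorph.subRight c)
  have hΘ'O : tsupport Θ' ⊆ O := by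
    have hsupp : Function.support Θ' ⊆ ball c (2 * R) := by
      intro y hy
      have hy' : y - c ∈ tsupport Θ := subset_tsupport _ (by simpa [hΘ'] using hy)
      have := hΘR hy'
      rw [mem_ball_zero_iff] at this
      rwa [mem_ball, dist_eq_norm]
    exact (closure_mono hsupp).trans
      (closure_ball_subset_closedBall.trans (closedBall_subset_ball hRR'))
  ----------------------------------------------------------------
  -- the inequality for the translated data
  ----------------------------------------------------------------
  have hmain := energyClass_ineq_acrossAxis_v3 hOopen hΨc hΨg hΨs hΨt hΨt' hWc hWs hdivW hW3 hsup' hk'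
    hH hH' hH0 hH2 hκ hHk hΘ'1 hΘ'c hΘ'O hη hη0 h1 h12 h2
  ----------------------------------------------------------------
  -- back to `Φ`: merge the drift and axis integrals, translate every integral
  ----------------------------------------------------------------
  have hA : MeasurableSet (Icc t₁ t₂) := measurableSet_Icc
  -- gradients of translates
  have eG1 : ∀ s y, gradient (Ψ s) y = gradient (Φ s) (y - c) := fun s y =>
    gradient_comp_sub_const (Φ s) c y
  have eG2 : ∀ y, gradient (fun w => Θ' w ^ 2) y = gradient (fun w => Θ w ^ 2) (y - c) := fun y =>
    gradient_comp_sub_const (fun w => Θ w ^ 2) c y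
  have eG3 : ∀ y, gradient Θ' y = gradient Θ (y - c) := fun y => gradient_comp_sub_const Θ c y
  -- slice integrals
  have eM : ∀ s, ∫ x, H (Ψ s x) * Θ' x ^ 2 = ∫ x, H (Φ s x) * Θ x ^ 2 := by
    intro s
    have h := integral_add_left_eq_self (μ := (volume : Measure (EuclideanSpace ℝ (Fin 3))))
      (fun x => H (Φ s x) * Θ x ^ 2) (-c)
    simp only [hΨ, hΘ', sub_eq_neg_add]
    simpa only using h
  -- the dissipation
  have eL : ∫⁻ z in Icc t₁ t₂ ×ˢ (univ : Set (EuclideanSpace ℝ (Fin 3))), ENNReal.ofReal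
        (1 / 2 * η z.1 * (deriv (deriv H) (Ψ z.1 z.2) * ‖gradient (Ψ z.1) z.2‖ ^ 2 * Θ' z.2 ^ 2)) =
      ∫⁻ z in Icc t₁ t₂ ×ˢ (univ : Set (EuclideanSpace ℝ (Fin 3))), ENNReal.ofReal
        (1 / 2 * η z.1 * (deriv (deriv H) (Φ z.1 z.2) * ‖gradient (Φ z.1) z.2‖ ^ 2 * Θ z.2 ^ 2)) := by
    have h := setLIntegral_prod_univ_comp_sub_right hA (fun z => ENNReal.ofReal
      (1 / 2 * η z.1 * (deriv (deriv H) (Φ z.1 z.2) * ‖gradient (Φ z.1) z.2‖ ^ 2 * Θ z.2 ^ 2))) c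
    simp only [eG1]
    simp only [hΨ, hΘ']
    simpa only using h
  -- the `|∇Θ|²` and `|η'|` terms
  have eP : (∫ z in Icc t₁ t₂ ×ˢ (univ : Set (EuclideanSpace ℝ (Fin 3))),
        η z.1 * (H (Ψ z.1 z.2) * ‖gradient Θ' z.2‖ ^ 2)) =
      ∫ z in Icc t₁ t₂ ×ˢ (univ : Set (EuclideanSpace ℝ (Fin 3))),
        η z.1 * (H (Φ z.1 z.2) * ‖gradient Θ z.2‖ ^ 2) := by
    have h := setIntegral_prod_univ_comp_sub_right hA
      (fun z => η z.1 * (H (Φ z.1 z.2) * ‖gradient Θ z.2‖ ^ 2)) c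
    simp only [eG3]
    simp only [hΨ]
    simpa only using h
  have eE : (∫ z in Icc t₁ t₂ ×ˢ (univ : Set (EuclideanSpace ℝ (Fin 3))),
        |deriv η z.1| * (H (Ψ z.1 z.2) * Θ' z.2 ^ 2)) =
      ∫ z in Icc t₁ t₂ ×ˢ (univ : Set (EuclideanSpace ℝ (Fin 3))),
        |deriv η z.1| * (H (Φ z.1 z.2) * Θ z.2 ^ 2) := by
    have h := setIntegral_prod_univ_comp_sub_right hA
      (fun z => |deriv η z.1| * (H (Φ z.1 z.2) * Θ z.2 ^ 2)) c
    simp only [hΨ, hΘ']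
    simpa only using h
  -- the drift and axis terms: integrable on the slab, and they add up to the `U`-drift term
  have hμ : (volume : Measure (ℝ × EuclideanSpace ℝ (Fin 3))).restrict
      (Icc t₁ t₂ ×ˢ (univ : Set (EuclideanSpace ℝ (Fin 3)))) =
      (volume.restrict (Ioc t₁ t₂)).prod volume :=
    restrict_Icc_prod_univ_eq_restrict_Ioc_prod t₁ t₂
  obtain ⟨-, -, i₃, i₄, -⟩ :=
    integrable_sliceIntegrands_acrossAxis hOopen hΨc hΨg hWc hW3 hH hΘ'1 hΘ'c hΘ'O h1 h2
  obtain ⟨C, hC⟩ : ∃ C, ∀ s ∈ Icc t₁ t₂, ‖η s‖ ≤ C :=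
    isCompact_Icc.exists_bound_of_continuousOn (hη.continuous.continuousOn)
  have hηm : AEStronglyMeasurable (fun z : ℝ × EuclideanSpace ℝ (Fin 3) => η z.1)
      ((volume : Measure (ℝ × EuclideanSpace ℝ (Fin 3))).restrict
        (Icc t₁ t₂ ×ˢ (univ : Set (EuclideanSpace ℝ (Fin 3))))) :=
    (hη.continuous.comp continuous_fst).aestronglyMeasurable
  have hηbd : ∀ᵐ z ∂((volume : Measure (ℝ × EuclideanSpace ℝ (Fin 3))).restrict
      (Icc t₁ t₂ ×ˢ (univ : Set (EuclideanSpace ℝ (Fin 3))))), ‖η z.1‖ ≤ C := by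
    filter_upwards [ae_restrict_mem (hA.prod MeasurableSet.univ)] with z hz
    exact hC z.1 hz.1
  have iD : Integrable (fun z : ℝ × EuclideanSpace ℝ (Fin 3) =>
      η z.1 * (H (Ψ z.1 z.2) * ⟪W z.1 z.2, gradient (fun y => Θ' y ^ 2) z.2⟫))
      ((volume : Measure (ℝ × EuclideanSpace ℝ (Fin 3))).restrict
        (Icc t₁ t₂ ×ˢ (univ : Set (EuclideanSpace ℝ (Fin 3))))) := by
    rw [hμ] at hηm hηbd ⊢
    exact i₃.bdd_mul hηm hηbd
  have iA : Integrable (fun z : ℝ × EuclideanSpace ℝ (Fin 3) =>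
      η z.1 * (2 / cylRadius z.2 * (H (Ψ z.1 z.2) * fderiv ℝ (fun y => Θ' y ^ 2) z.2 (eR z.2))))
      ((volume : Measure (ℝ × EuclideanSpace ℝ (Fin 3))).restrict
        (Icc t₁ t₂ ×ˢ (univ : Set (EuclideanSpace ℝ (Fin 3))))) := by
    rw [hμ] at hηm hηbd ⊢
    exact i₄.bdd_mul hηm hηbd
  have eDA : (∫ z in Icc t₁ t₂ ×ˢ (univ : Set (EuclideanSpace ℝ (Fin 3))),
        η z.1 * (H (Ψ z.1 z.2) * ⟪W z.1 z.2, gradient (fun y => Θ' y ^ 2) z.2⟫)) +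
      (∫ z in Icc t₁ t₂ ×ˢ (univ : Set (EuclideanSpace ℝ (Fin 3))),
        η z.1 * (2 / cylRadius z.2 * (H (Ψ z.1 z.2) * fderiv ℝ (fun y => Θ' y ^ 2) z.2 (eR z.2)))) =
      ∫ z in Icc t₁ t₂ ×ˢ (univ : Set (EuclideanSpace ℝ (Fin 3))),
        η z.1 * (H (Φ z.1 z.2) * ⟪U z.1 z.2, gradient (fun y => Θ y ^ 2) z.2⟫) := by
    rw [← integral_add iD iA]
    have h := setIntegral_prod_univ_comp_sub_right hA
      (fun z => η z.1 * (H (Φ z.1 z.2) * ⟪U z.1 z.2, gradient (fun y => Θ y ^ 2) z.2⟫)) c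
    simp only at h
    rw [← h]
    refine integral_congr_ae (ae_of_all _ fun z => ?_)
    have e4 : W z.1 z.2 = U z.1 (z.2 - c) - (2 / cylRadius z.2) • eR z.2 := by
      show Us z.1 z.2 - RD z.2 = _
      rw [hRDeq]
    simp only [hΨ]
    rw [e4, ← inner_gradient_left, eG2, inner_sub_left, real_inner_smul_left,
      real_inner_comm (eR z.2)]
    ring
  ----------------------------------------------------------------
  -- assemble
  ----------------------------------------------------------------
  have key := hmain
  rw [eM t₂, eM t₁, eL, eP, eE] at key
  have eDA' : ∀ X Y : ℝ,
      X + (∫ z in Icc t₁ t₂ ×ˢ (univ : Set (EuclideanSpace ℝ (Fin 3))),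
          η z.1 * (H (Ψ z.1 z.2) * ⟪W z.1 z.2, gradient (fun y => Θ' y ^ 2) z.2⟫)) +
        (∫ z in Icc t₁ t₂ ×ˢ (univ : Set (EuclideanSpace ℝ (Fin 3))),
          η z.1 * (2 / cylRadius z.2 * (H (Ψ z.1 z.2) * fderiv ℝ (fun y => Θ' y ^ 2) z.2 (eR z.2)))) +
        Y =
      X + (∫ z in Icc t₁ t₂ ×ˢ (univ : Set (EuclideanSpace ℝ (Fin 3))),
          η z.1 * (H (Φ z.1 z.2) * ⟪U z.1 z.2, gradient (fun y => Θ y ^ 2) z.2⟫)) + Y := by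
    intro X Y
    rw [add_assoc X, eDA]
  rw [eDA'] at key
  exact key
end Summit.NavierStokesRegularity.NavierStokesRegularity.Theorems.AveragedConeLiouville.NUPositivity

end
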